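import Literature.Topology.FourManifolds.KhComplexFaceProofs
import Literature.Topology.FourManifolds.KhFlipDegree
import HarnessLib

/-!
# One face of the cube of resolutions anticommutes (local form, every Gauss diagram)

Sibling file of `KhComplexFaceProofs.lean` (topic `Literature/Topology/FourManifolds`), a brick of
the invariance programme for
`Literature.Topology.FourManifolds.GaussDiagram.nonempty_iso_khovanovHomology_of_equiv`
(Khovanov (2000), Thm. 1). `KhComplexFaceProofs` derives `d² = 0` from the *global* hypothesis that
every edge of the cube is a merge or a split. The chain maps of the first Reidemeister move
(Khovanov (2000), §5.1–5.2) need only the faces spanned by an old chord and the curl chord, and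
those anticommute for *every* Gauss diagram (the curl chord is always a merge or a split,
`KhCurlArcs`); so we record the face identity locally:

* `sum_incidence_mul_incidence_face_local` — if the four edges of the face of the cube spanned by
  two `0`-smoothed chords `i ≠ j` of a state `σ` are merges or splits, then
  `∑ₓ ⟨d s, x⟩ ⟨d x, s'⟩ = 0` for `s` over `σ` and `s'` over `σ[i ↦ 1][j ↦ 1]` (the proof of
  `KhComplexFaceProofs.sum_incidence_mul_incidence_face`, verbatim, with the hypothesis used
  only where it is needed: the abstract face theorem `KhFace.face_comm` and the sign rule
  `edgeSign_mul_edgeSign_update`);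
* `sum_incidence_mul_incidence_face_of_not` — if instead the two edges flipping `i` (from `σ` and
  from `σ[j ↦ 1]`) are neither merges nor splits (one-to-one bifurcations, virtual diagrams), the
  same sum vanishes termwise, both paths containing a zero incidence number.

No named fact is introduced.

## References

* M. Khovanov, *A categorification of the Jones polynomial*, Duke Math. J. 101 (2000) 359–426,
  §3.3 (the skew cube), Prop. 8 (faces commute). [cite: Khovanov2000, Prop. 8]
* D. Bar-Natan, *On Khovanov's categorification of the Jones polynomial*, Algebr. Geom. Topol. 2
  (2002) 337–370, §3.2. [cite: BarNatan2002, §3.2]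
* O. Viro, *Khovanov homology, its definitions and ramifications*, Fund. Math. 184 (2004), §5.2
  (incidence numbers; the one-to-one bifurcation has incidence `0`). [cite: Viro2004, §5.2]
-/

open Function Finset

noncomputable section

namespace Literature.Topology.FourManifolds

namespace GaussDiagram

variable {G : GaussDiagram} {R : Type} [CommRing R]

/-- Only the two intermediate states of a face can contribute to `∑ₓ ⟨d s, x⟩ ⟨d x, s'⟩` when
`s'.state = σ[i ↦ 1][j ↦ 1]`: a nonzero term has `x.state = σ[i ↦ 1]` or `x.state = σ[j ↦ 1]`.
[folklore] -/
theorem state_eq_or_of_incidence_mul_incidence_ne_zero (h t : R) {s x s' : G.EnhancedState}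
    {i j : Fin G.n} (hs' : s'.state = Function.update (Function.update s.state i true) j true)
    (h0 : G.incidence R h t s x * G.incidence R h t x s' ≠ 0) :
    x.state = Function.update s.state i true ∨ x.state = Function.update s.state j true := by
  have h1 : G.incidence R h t s x ≠ 0 := fun e ↦ h0 (by rw [e, zero_mul])
  have h2 : G.incidence R h t x s' ≠ 0 := fun e ↦ h0 (by rw [e, mul_zero])
  obtain ⟨k, hk, hxk⟩ := exists_of_incidence_ne_zero h1
  obtain ⟨l, -, hs'l⟩ := exists_of_incidence_ne_zero h2
  -- `k` is a `0`-smoothing of `σ` flipped in `s'`: `k = i` or `k = j`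
  have h3 : Function.update (Function.update s.state i true) j true k = true := by
    rw [← hs', hs'l, hxk]
    by_cases hkl : k = l
    · subst hkl
      rw [Function.update_self]
    · rw [Function.update_of_ne hkl, Function.update_self]
  by_cases hkj : k = j
  · exact Or.inr (by rw [hxk, hkj])
  · rw [Function.update_of_ne hkj] at h3
    by_cases hki : k = i
    · exact Or.inl (by rw [hxk, hki])
    · rw [Function.update_of_ne hki, hk] at h3
      exact absurd h3 Bool.false_ne_true

/-- An incidence number along an edge which is neither a merge nor a split (a one-to-one
bifurcation) vanishes, for any labels. Viro (2004), §5.2. [cite: Viro2004, §5.2] -/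
theorem incidence_eq_zero_of_not_isMergeAt_of_not_isSplitAt (h t : R) {s x : G.EnhancedState}
    {i : Fin G.n} (hi : s.state i = false) (hx : x.state = Function.update s.state i true)
    (hm : ¬ G.IsMergeAt s.state i) (hsp : ¬ G.IsSplitAt s.state i) :
    G.incidence R h t s x = 0 := by
  rw [incidence_of_flip R h t hi hx, if_neg hm, if_neg hsp]

/-- **A face of the cube anticommutes (local form).** Let `i ≠ j` be `0`-smoothed chords of the
state `σ` such that the four edges of the face `σ → σ[i ↦ 1] → σ[i ↦ 1][j ↦ 1]`,
`σ → σ[j ↦ 1] → σ[j ↦ 1][i ↦ 1]` are merges or splits. Then for every enhanced state `s` over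
`σ` and `s'` over `σ[i ↦ 1][j ↦ 1]`, `∑ₓ ⟨d s, x⟩ ⟨d x, s'⟩ = 0`: the two paths contribute the same
unsigned sum (`KhFace.face_comm`) with opposite Koszul signs (`edgeSign_mul_edgeSign_update`).
This is `KhComplexFaceProofs.sum_incidence_mul_incidence_face` with its merge-or-split hypothesis
restricted to the four edges, so that it applies to every Gauss diagram at the faces that matter
for the Reidemeister moves. Khovanov (2000), Prop. 8 and §3.3; Bar-Natan (2002), §3.2.
[cite: Khovanov2000, Prop. 8] -/
theorem sum_incidence_mul_incidence_face_local (h t : R) {σ : G.State} {la : G.Arc → Bool}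
    {hla : ∀ a b, (G.stateGraph σ).Adj a b → la a = la b} {nu : G.Arc → Bool} {i j : Fin G.n}
    (hij : i ≠ j) (hi : σ i = false) (hj : σ j = false)
    {hnu : ∀ a b, (G.stateGraph (Function.update (Function.update σ i true) j true)).Adj a b →
      nu a = nu b}
    (h₁ : G.IsMergeAt σ i ∨ G.IsSplitAt σ i)
    (h₂ : G.IsMergeAt (Function.update σ i true) j ∨ G.IsSplitAt (Function.update σ i true) j)
    (h₃ : G.IsMergeAt σ j ∨ G.IsSplitAt σ j)
    (h₄ : G.IsMergeAt (Function.update σ j true) i ∨ G.IsSplitAt (Function.update σ j true) i) :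
    ∑ x : G.EnhancedState, G.incidence R h t ⟨σ, la, hla⟩ x *
      G.incidence R h t x ⟨Function.update (Function.update σ i true) j true, nu, hnu⟩ = 0 := by
  classical
  have hσij : Function.update σ i true j = false := by
    rw [Function.update_of_ne (Ne.symm hij), hj]
  have hσji : Function.update σ j true i = false := by
    rw [Function.update_of_ne hij, hi]
  have hcomm : Function.update (Function.update σ i true) j true =
      Function.update (Function.update σ j true) i true :=
    Function.update_comm hij true true σ
  have hne : Function.update σ i true ≠ Function.update σ j true := fun h' ↦ by
    have := congrFun h' i
    rw [Function.update_self, hσji] at this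
    exact Bool.noConfusion this
  -- Step A: only the two intermediate states of the face contribute
  have hsplit : ∀ x : G.EnhancedState, G.incidence R h t ⟨σ, la, hla⟩ x *
      G.incidence R h t x ⟨Function.update (Function.update σ i true) j true, nu, hnu⟩ =
      (if x.state = Function.update σ i true then G.incidence R h t ⟨σ, la, hla⟩ x *
        G.incidence R h t x ⟨Function.update (Function.update σ i true) j true, nu, hnu⟩
        else 0) +
      (if x.state = Function.update σ j true then G.incidence R h t ⟨σ, la, hla⟩ x *
        G.incidence R h t x ⟨Function.update (Function.update σ i true) j true, nu, hnu⟩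
        else 0) := by
    intro x
    by_cases hxi : x.state = Function.update σ i true
    · rw [if_pos hxi, if_neg (fun hxj ↦ hne (hxi.symm.trans hxj)), add_zero]
    by_cases hxj : x.state = Function.update σ j true
    · rw [if_neg hxi, if_pos hxj, zero_add]
    rw [if_neg hxi, if_neg hxj, add_zero]
    by_contra h0
    rcases state_eq_or_of_incidence_mul_incidence_ne_zero h t (s := ⟨σ, la, hla⟩)
      (s' := ⟨Function.update (Function.update σ i true) j true, nu, hnu⟩) rfl h0 with
      hx | hx
    · exact hxi hx
    · exact hxj hx
  -- Step B: each path is (sign) · (sign) · (abstract face sum)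
  have hpath₁ : ∑ x : G.EnhancedState,
      (if x.state = Function.update σ i true then G.incidence R h t ⟨σ, la, hla⟩ x *
        G.incidence R h t x ⟨Function.update (Function.update σ i true) j true, nu, hnu⟩
        else 0) =
      ((edgeSign σ i * edgeSign (Function.update σ i true) j : ℤ) : R) *
        ∑ mu : KhFace.Lab (G.circleOf (Function.update σ i true)),
          KhFace.edgeVal R h t (G.kindAt σ i) (G.circleOf σ)
              (G.circleOf (Function.update σ i true)) la mu.1
              (G.arcIn (G.overPos i)) (G.arcOut (G.overPos i)) *
            KhFace.edgeVal R h t (G.kindAt (Function.update σ i true) j)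
              (G.circleOf (Function.update σ i true))
              (G.circleOf (Function.update (Function.update σ i true) j true)) mu.1 nu
              (G.arcIn (G.overPos j)) (G.arcOut (G.overPos j)) := by
    rw [sum_ite_state_eq, Finset.mul_sum]
    refine Finset.sum_congr rfl fun mu _ ↦ ?_
    rw [incidence_eq_edgeVal h t (s := ⟨σ, la, hla⟩) (x := G.ofLab _ mu) (i := i) h₁ hi rfl,
      incidence_eq_edgeVal h t (s := G.ofLab _ mu)
        (x := ⟨Function.update (Function.update σ i true) j true, nu, hnu⟩) (i := j)
        h₂ hσij rfl]
    dsimp only [ofLab]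
    push_cast
    ring
  have hpath₂ : ∑ x : G.EnhancedState,
      (if x.state = Function.update σ j true then G.incidence R h t ⟨σ, la, hla⟩ x *
        G.incidence R h t x ⟨Function.update (Function.update σ i true) j true, nu, hnu⟩
        else 0) =
      ((edgeSign σ j * edgeSign (Function.update σ j true) i : ℤ) : R) *
        ∑ mu : KhFace.Lab (G.circleOf (Function.update σ j true)),
          KhFace.edgeVal R h t (G.kindAt σ j) (G.circleOf σ)
              (G.circleOf (Function.update σ j true)) la mu.1
              (G.arcIn (G.overPos j)) (G.arcOut (G.overPos j)) *
            KhFace.edgeVal R h t (G.kindAt (Function.update σ j true) i)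
              (G.circleOf (Function.update σ j true))
              (G.circleOf (Function.update (Function.update σ i true) j true)) mu.1 nu
              (G.arcIn (G.overPos i)) (G.arcOut (G.overPos i)) := by
    rw [sum_ite_state_eq, Finset.mul_sum]
    refine Finset.sum_congr rfl fun mu _ ↦ ?_
    rw [incidence_eq_edgeVal h t (s := ⟨σ, la, hla⟩) (x := G.ofLab _ mu) (i := j) h₃ hj rfl,
      incidence_eq_edgeVal h t (s := G.ofLab _ mu)
        (x := ⟨Function.update (Function.update σ i true) j true, nu, hnu⟩) (i := i)
        h₄ hσji hcomm]
    dsimp only [ofLab]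
    push_cast
    ring
  -- Step C: the abstract face theorem and the sign rule
  have hface : ∑ mu : KhFace.Lab (G.circleOf (Function.update σ i true)),
      KhFace.edgeVal R h t (G.kindAt σ i) (G.circleOf σ)
          (G.circleOf (Function.update σ i true)) la mu.1
          (G.arcIn (G.overPos i)) (G.arcOut (G.overPos i)) *
        KhFace.edgeVal R h t (G.kindAt (Function.update σ i true) j)
          (G.circleOf (Function.update σ i true))
          (G.circleOf (Function.update (Function.update σ i true) j true)) mu.1 nu
          (G.arcIn (G.overPos j)) (G.arcOut (G.overPos j)) =
      ∑ mu : KhFace.Lab (G.circleOf (Function.update σ j true)),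
        KhFace.edgeVal R h t (G.kindAt σ j) (G.circleOf σ)
            (G.circleOf (Function.update σ j true)) la mu.1
            (G.arcIn (G.overPos j)) (G.arcOut (G.overPos j)) *
          KhFace.edgeVal R h t (G.kindAt (Function.update σ j true) i)
            (G.circleOf (Function.update σ j true))
            (G.circleOf (Function.update (Function.update σ i true) j true)) mu.1 nu
            (G.arcIn (G.overPos i)) (G.arcOut (G.overPos i)) := by
    -- (`convert`: the `Fintype` instances on labellings found in the abstract and in the
    -- concrete context differ by a `Subsingleton`)
    convert KhFace.face_comm (R := R) (h := h) (t := t) (G.kindAt σ i)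
      (G.kindAt (Function.update σ i true) j) (G.kindAt σ j) (G.kindAt (Function.update σ j true) i)
      (edgeOK_kindAt h₁ rfl) (edgeOK_kindAt h₂ rfl) (edgeOK_kindAt h₃ rfl)
      (edgeOK_kindAt h₄ hcomm)
      ⟨la, fun a b hab ↦ (⟨σ, la, hla⟩ : G.EnhancedState).label_eq_of_circleOf_eq hab⟩
      ⟨nu, fun a b hab ↦ (⟨Function.update (Function.update σ i true) j true, nu, hnu⟩ :
        G.EnhancedState).label_eq_of_circleOf_eq hab⟩ using 3
  have hsign := congrArg (fun z : ℤ ↦ (z : R)) (edgeSign_mul_edgeSign_update hij hi hj)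
  simp only [Int.cast_neg] at hsign
  rw [Finset.sum_congr rfl fun x _ ↦ hsplit x, Finset.sum_add_distrib, hpath₁, hpath₂, hface,
    hsign]
  ring

/-- **A face whose `i`-edges are one-to-one bifurcations vanishes termwise.** If the flips of
`i` from `σ` and from `σ[j ↦ 1]` are neither merges nor splits, then `∑ₓ ⟨d s, x⟩ ⟨d x, s'⟩ = 0`
for `s` over `σ`, `s'` over `σ[i ↦ 1][j ↦ 1]`: each of the two paths of the face contains an
incidence number along an `i`-edge, which is `0` (Viro (2004), §5.2: incidence `0` at a
one-to-one bifurcation). [folklore] -/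
theorem sum_incidence_mul_incidence_face_of_not (h t : R) {s s' : G.EnhancedState} {i j : Fin G.n}
    (hij : i ≠ j) (hi : s.state i = false)
    (hs' : s'.state = Function.update (Function.update s.state i true) j true)
    (hn₁ : ¬ G.IsMergeAt s.state i ∧ ¬ G.IsSplitAt s.state i)
    (hn₂ : ¬ G.IsMergeAt (Function.update s.state j true) i ∧
      ¬ G.IsSplitAt (Function.update s.state j true) i) :
    ∑ x : G.EnhancedState, G.incidence R h t s x * G.incidence R h t x s' = 0 := by
  refine Finset.sum_eq_zero fun x _ ↦ ?_
  by_contra h0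
  rcases state_eq_or_of_incidence_mul_incidence_ne_zero h t hs' h0 with hx | hx
  · -- the first edge of the path flips `i` from `σ`
    exact h0 (by rw [incidence_eq_zero_of_not_isMergeAt_of_not_isSplitAt h t hi hx hn₁.1 hn₁.2,
      zero_mul])
  · -- the second edge of the path flips `i` from `σ[j ↦ 1]`
    have hxi : x.state i = false := by rw [hx, Function.update_of_ne hij, hi]
    have hs'' : s'.state = Function.update x.state i true := by
      rw [hs', hx, Function.update_comm hij]
    have hm : ¬ G.IsMergeAt x.state i := by rw [hx]; exact hn₂.1
    have hsp : ¬ G.IsSplitAt x.state i := by rw [hx]; exact hn₂.2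
    exact h0 (by rw [incidence_eq_zero_of_not_isMergeAt_of_not_isSplitAt h t hxi hs'' hm hsp,
      mul_zero])

end GaussDiagram

end Literature.Topology.FourManifolds
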